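import Summits.QuantumFields.YangMills.Theorems.AllWindowsColdBoxBoxHighLineFPChartWeightOnSmallField

/-!
# T-S5.5n — repaired task Prop `FPChartWeightOnSmallFieldR` (planner ym-idea-2 g18, 2026-08-29T20:2xZ)

The Step-2 task Prop `FPChartWeightOnSmallField` (crux file `TaskS5Step2Tilt.lean` 66848343b9c6 = Theorems copy
`…Step2Tilt.lean` p741027) is **false as typed** in the degenerate corner `r = s = 0` — refuted in the tree by w4 g28:
`not_fpChartWeightOnSmallField` (p742200; witness `H = 1`, `a = 0`: `ballCutoff H 0 ≡ 0`).  Class: **misstated** (typing checklist 4c(iv):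
degenerate parameter).  The repaired statement inserts the single binder `0 < r` (every consumer has `0 < s`, `4 s ≤ r`), and is ALREADY a tree
theorem: `fpChartWeightOnSmallField_pos` / `fpChartWeight_eq_on_smallField` (p742200).  This file records the repaired Prop under a NEW name
(Theorems are append-only; the false Prop stays as a settled negative edge) and closes it by name, so ASSEMBLY-S5 Step D cites `fpChartWeightOnSmallFieldR`.
-/

open MeasureTheory Matrix Finset Real
open Literature.MathematicalPhysics.QuantumFieldTheory.Balaban1983to89.B10Eq22Rescaling (sigmaSU2)

namespace Summit.QuantumFields.YangMills.Theorems.AllWindowsColdBoxBoxHighLine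

/-- **T-S5.5n (repaired) `FPChartWeightOnSmallFieldR`** — exact factorisation of the FP chart weight on the small-field set, with the non-degeneracy
binder `0 < r` (the only change w.r.t. `FPChartWeightOnSmallField`, inserted after `s < Real.pi`). -/
def FPChartWeightOnSmallFieldR : Prop :=
  ∀ H : ℕ, 1 ≤ H → ∀ β r s : ℝ, 0 ≤ s → s ≤ r → s < Real.pi → 0 < r → ∀ a ∈ smallField H s,
    (fpOperator H (edgeChart H a)).det ≠ 0 →
    fpChartWeight β H r a =
      |(fpOperator H 1).det| * sigmaSU2 0 ^ Fintype.card (LandauFree H) * gaussWeight β H a * Real.exp (tiltU β H a)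

/-- The repaired task is closed by name (w4 g28, p742200). -/
theorem fpChartWeightOnSmallFieldR_holds : FPChartWeightOnSmallFieldR :=
  fpChartWeightOnSmallField_pos

/-- … and the original task Prop is refuted (w4 g28, p742200). -/
theorem fpChartWeightOnSmallField_false : ¬ FPChartWeightOnSmallField :=
  not_fpChartWeightOnSmallField

end Summit.QuantumFields.YangMills.Theorems.AllWindowsColdBoxBoxHighLine
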